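import Summits.HodgeConjecture.HodgeCM.Model.HypCensus.IsoTwist_1

/-! PORT of `HodgeCM/Model/HypCensus/IsoTwist.lean` (HodgeCMPerL run 82) — part 2: continuation of `Summits.HodgeConjecture.HodgeCM.Model.HypCensus.IsoTwist_1` (split at a top-level declaration boundary by port_pkg.py; scope re-opened below; declarations unchanged). -/

-- port_pkg: scope re-opened for this part (file-level context, then the namespace/section stack open at the cut)
set_option autoImplicit false
noncomputable section
open NumberField NumberField.InfinitePlace
open scoped Matrix Classical ComplexConjugate
open Literature.NumberTheory.Automorphic Literature.NumberTheory.Automorphic.UnitaryGroup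
open HodgeCM.PerL34
namespace HodgeCM.Model.HypCensus
section Place
variable (L : Type) [Field L] [NumberField L] [IsCMField L]
variable (dW dW' : Fin 2 → L) (hdW : ∀ i, IsCMField.complexConj L (dW i) = dW i) (hdW0 : ∀ i, dW i ≠ 0)
  (hdW' : ∀ i, IsCMField.complexConj L (dW' i) = dW' i) (hdW0' : ∀ i, dW' i ≠ 0)
  (g : GL (Fin 2) L)
  (hg : ((g : Matrix (Fin 2) (Fin 2) L).map (Literature.AlgebraicGeometry.ShimuraVarieties.conjRingHomK L))ᵀ * Matrix.diagonal dW *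
    (g : Matrix (Fin 2) (Fin 2) L) = Matrix.diagonal dW')
omit [NumberField L] [IsCMField L] in
/-- the `w`-component of the rational frame `g ⊗ 1` is `σ_w(g)`. -/
theorem map_evalC_archGL (w : {w : InfinitePlace L // w.IsComplex}) :
    Matrix.GeneralLinearGroup.map (evalC L w) (archGL L g) = Matrix.GeneralLinearGroup.map w.1.embedding g :=
  Units.ext (Matrix.ext fun i j => by
    rw [coe_GL_map_eq_map, coe_GL_map_eq_map, Matrix.map_apply, Matrix.map_apply, val_archGL, Matrix.map_apply,
      evalC_apply, NumberField.mixedEmbedding.mixedEmbedding_apply_isComplex])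

omit [IsCMField L] in
/-- `![↑a, ↑b] = (↑) ∘ ![a, b]` on `Fin 2`. -/
theorem vec_two_coe (p : Circle × Circle) (k : Fin 2) : (![(p.1 : ℂ), (p.2 : ℂ)] k) = ((![p.1, p.2] k : Circle) : ℂ) := by
  fin_cases k <;> rfl

/-- the `w`-component of `diag(u₀, u₁)` is `diag(ι_w u₀, ι_w u₁)` in the circle coordinates `placesEquiv`. -/
theorem coe_map_evalC_archDiagGL (w : {w : InfinitePlace L // w.IsComplex}) (u : SeesawArchTorus L) :
    ((Matrix.GeneralLinearGroup.map (evalC L w) (archDiagGL L u) : GL (Fin 2) ℂ) : Matrix (Fin 2) (Fin 2) ℂ) =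
      Matrix.diagonal fun k => ((![(SeesawArchTorus.placesEquiv L u w.1).1, (SeesawArchTorus.placesEquiv L u w.1).2] k : Circle) : ℂ) := by
  ext i j
  rw [coe_GL_map_eq_map, Matrix.map_apply, val_archDiagGL, Matrix.diagonal_apply, Matrix.diagonal_apply]
  split_ifs with h
  · subst h
    fin_cases i <;> rfl
  · exact map_zero _

/-- **HEADLINE (J-T34, archimedean half): the (34) torus element is conjugate INSIDE `U(diag dW)(L⁺ ⊗ ℝ)` to the diagonal torus with
place-wise permuted entries**: `(isoTwist g)⁻¹ · (g · diag(u) · g⁻¹) · isoTwist g = diag(torusSwap σ⁻¹ u)`. -/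
theorem isoTwist_conj_archConjDiag (u : SeesawArchTorus L) :
    (isoTwist L dW dW' hdW hdW0 hdW' hdW0' g hg)⁻¹ * archConjDiag L g dW dW' hg u * isoTwist L dW dW' hdW hdW0 hdW' hdW0' g hg =
      archDiag L dW (torusSwap L (fun w => (placePerm L dW dW' w).symm) u) := by
  apply (archPiEquiv (↥(maximalRealSubfield L)) L (IsCMField.complexConj L) 2 (Matrix.diagonal dW) (IsCMField.complexConj_ne_one L)
    (UnitaryGroup.complexConj_smul_infinitePlace L)).injective
  funext w
  rw [map_mul, map_mul, map_inv, Pi.mul_apply, Pi.mul_apply, Pi.inv_apply, archPiEquiv_apply, archPiEquiv_apply, archPiEquiv_apply,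
    archAt_isoTwist]
  apply Subtype.ext
  rw [Subgroup.coe_mul, Subgroup.coe_mul, Subgroup.coe_inv, coe_archAt, coe_archAt, coe_archConjDiag, map_mul, map_mul, map_inv,
    map_evalC_archGL, coe_archDiag]
  show (isoLocGL L dW dW' hdW hdW0 hdW' hdW0' g hg w)⁻¹ * _ * isoLocGL L dW dW' hdW hdW0 hdW' hdW0' g hg w = _
  have hgrp : ∀ G d Δ : GL (Fin 2) ℂ, (G * d⁻¹)⁻¹ * (G * Δ * G⁻¹) * (G * d⁻¹) = d * Δ * d⁻¹ := fun G d Δ => by group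
  rw [isoLocGL, hgrp]
  apply Units.ext
  rw [Units.val_mul, Units.val_mul, coe_isoMatGL, coe_isoMatGL_inv, coe_map_evalC_archDiagGL, coe_map_evalC_archDiagGL,
    isoMat_mul_diagonal_mul_isoMatInv (placeScale_ne_zero L dW dW' hdW hdW0 hdW' hdW0' g hg w.1), placesEquiv_torusSwap]
  congr 1
  funext j
  fin_cases j <;> rfl

end Place


end HodgeCM.Model.HypCensus

end
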